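import Summits.ResolutionOfSingularities.ResolutionOfSingularities.Theorems.HilbertSamuelEliminationSigmaMaxModificationsCorridor3WLadderIsoKernelCurveShadowChain
import Summits.ResolutionOfSingularities.ResolutionOfSingularities.Theorems.FrobeniusClosingSteerHironakaLUBranchOfCPPrelims
import HarnessLib

/-!
# [OURS · L1 W4.2] THE CURVE-SHADOW THEOREM, SUBRING FORM: a chain of local rings inside a local OVERRING `C` (the curve's generic local
# ring) is eventually free-rational — non-satellite steps and no residue jumps from some stage on

Crux chain w42 (`SigmaMaxModifications`, stmt-ResolutionOfSingularities-18506; conjunct `SigmaMaxModificationsCorridor3`, stmt-…-19249),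
line `w_ladder`, registered stub `stub_isoSepRecurrent` (K2-sep ∧ K3-sep) of skeleton v8.8 — kernel census «NO ISOLATED E3 POINT TOWER FOLLOWS A
CURVE» (lead res-L1-w42-lead-1, gen 6), file 3/4 (1 = `…IsoKernelKrullAkizukiFractions`, 2 = `…IsoKernelCurveShadowChain`, 4 = the scheme-level
transport onto `IsIsoPointTower` + K1). Helper file `--supports stmt-ResolutionOfSingularities-19249`; kernel only (no definition, no named fact).

WHAT IS PROVED. `eventually_free_rational_of_overring`: `B 0 ≤ B 1 ≤ ⋯` local subrings of a field `L`, each dominating the previous one, `B 0`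
Noetherian, `𝔪(B n)·B(n+1)` principal (quadratic-transform shape); `C ⊇ B n` a LOCAL OVERRING with (a) some element of `𝔪(B 0)` a unit of `C`
(the curve is not the point), (b) every element of `C` a fraction `a/b`, `a, b ∈ B 0`, `b` a unit of `C` (`C` is the local ring of `B 0` at the
curve), (c) `B 0 ⧸ (𝔪(C) ∩ B 0)` of Krull dimension `≤ 1` (IT IS A CURVE). Then from some `n₀` on: every step is NON-SATELLITE
(`𝔪(B(n+1)) ⊆ t · B(n+2)` for some `t ∈ 𝔪(B n)`) and has NO RESIDUE JUMP (every `y ∈ B(n+1)` is congruent mod `𝔪(B(n+1))` to an element of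
`B n`). Proof: read the chain in `κ(C)` by `φ n = (B n ≤ C → κ(C))`; the images `φ n (B n) ≅ B n ⧸ (𝔪(C) ∩ B n)` are local rings whose maximal
ideals are the images of the `𝔪(B n)` (`𝔪(C) ∩ B n ⊆ 𝔪(B n)`), forming a dominating chain; Chevalley (res-type-026's
`exists_valuationSubring_dominates`) gives a valuation ring `W` of `κ(C)` dominating all of them; then file 2's (i) `eventually_not_satellite_of_shadow`
and (ii) `eventually_residue_surjective_of_shadow` apply. Auxiliary: `mem_maximalIdeal_of_inclusion_mem_maximalIdeal`.

HONEST FRAMING. OURS plumbing over textbook commutative algebra (Krull–Akizuki: Matsumura Thm. 11.7; Chevalley: Matsumura Thm. 10.2; Abhyankar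
1956 Thm. 1); nothing here is a statement of H. Hironaka's manuscript [Hironaka2017] nor of [CossartJannsenSaito2020] / [CossartPiltant2009].
AI-written; AI review is weaker than expert review.
References: H. Matsumura, *Commutative ring theory*, Thm. 10.2, Thm. 11.7 [Matsumura1987]; S. S. Abhyankar, Amer. J. Math. 78 (1956), Thm. 1
[Abhyankar1956Valuations]; S. D. Cutkosky, resolution notes §2.1 (domination) [Cutkosky2014].
-/

noncomputable section

set_option linter.dupNamespace false

open IsLocalRing
open Literature.AlgebraicGeometry.Resolution
open Summit.ResolutionOfSingularities.ResolutionOfSingularities.Theorems.SwitchingDichotomy.HironakaLUBranchOfCP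
  (exists_valuationSubring_dominates)

namespace Summit.ResolutionOfSingularities.ResolutionOfSingularities.Cruxes.SigmaMaxModifications.IdeasL1C5

universe u

/-! ## §4. THE SHADOW GIVEN BY A LOCAL OVERRING `C` (the local ring of the curve's generic point inside `L`): the readings
`φ n : B n ≤ C → κ(C)`, a valuation ring of `κ(C)` dominating their images (Chevalley), and the two conclusions together -/

section Overring

variable {L : Type u} [Field L] {B : ℕ → Subring L} [hloc : ∀ n, IsLocalRing (B n)]
  (hdom : ∀ n, SubringDominates (B n) (B (n + 1)))
  (C : Subring L) [IsLocalRing C] (hBC : ∀ n, B n ≤ C)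

/-- A proper-ideal remark: an element of `B n` lying in `𝔪(C)` lies in `𝔪(B n)`. [folklore] -/
theorem mem_maximalIdeal_of_inclusion_mem_maximalIdeal (n : ℕ) {x : B n}
    (hx : Subring.inclusion (hBC n) x ∈ maximalIdeal C) : x ∈ maximalIdeal (B n) := by
  by_contra h
  have hu := (IsLocalRing.notMem_maximalIdeal.mp h).map (Subring.inclusion (hBC n))
  exact (IsLocalRing.mem_maximalIdeal _).mp hx hu

include hdom in
/-- **THE CURVE-SHADOW THEOREM, SUBRING FORM.** `B 0 ≤ B 1 ≤ ⋯` local subrings of `L`, each dominating the previous one, `B 0` Noetherian,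
with `𝔪(B n)·B(n+1)` principal; `C ⊇ B n` a local subring (the local ring of the generic point of the shadowing curve) such that: some element
of `𝔪(B 0)` is a unit of `C` (the curve is not the point), every element of `C` is a fraction `a / b` of elements of `B 0` with `b` a unit of
`C` (`C` is the localization of `B 0` at the curve), and `B 0 ⧸ (𝔪(C) ∩ B 0)` has Krull dimension `≤ 1` (IT IS A CURVE). Then from some `n₀`
on every step is NON-SATELLITE and WITHOUT RESIDUE JUMP (element forms). Proof: read the chain in `κ(C)` by `φ n = (B n ≤ C → κ(C))`, take a
valuation ring of `κ(C)` dominating the chain of images (Chevalley), and apply §3 (i), (ii).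
[cite: Matsumura1987, Thm. 11.7, Thm. 10.2] [cite: Abhyankar1956Valuations, Thm. 1] -/
theorem eventually_free_rational_of_overring [IsNoetherianRing (B 0)]
    (hprin : ∀ n, ∃ t ∈ maximalIdeal (B n), ∀ x ∈ maximalIdeal (B n), ∃ y : B (n + 1), (x : L) = y * t)
    (hsep : ∃ x ∈ maximalIdeal (B 0), Subring.inclusion (hBC 0) x ∉ maximalIdeal C)
    (hfracC : ∀ z : C, ∃ a b : B 0, Subring.inclusion (hBC 0) b ∉ maximalIdeal C ∧ (z : L) * b = a)
    (hdim : Ring.KrullDimLE 1 (B 0 ⧸ (maximalIdeal C).comap (Subring.inclusion (hBC 0)))) :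
    ∃ n₀, ∀ n, n₀ ≤ n →
      (∃ t ∈ maximalIdeal (B n), ∀ x ∈ maximalIdeal (B (n + 1)), ∃ y : B (n + 2), (x : L) = y * t) ∧
      (∀ y : B (n + 1), ∃ x : B n, y - Subring.inclusion (hdom n).1 x ∈ maximalIdeal (B (n + 1))) := by
  classical
  -- the readings
  let F := ResidueField C
  let φ : ∀ n, B n →+* F := fun n => (residue C).comp (Subring.inclusion (hBC n))
  have hφapp : ∀ n (x : B n), φ n x = residue C (Subring.inclusion (hBC n) x) := fun n x => rfl
  have hφ : ∀ n (x : B n), φ (n + 1) (Subring.inclusion (hdom n).1 x) = φ n x := fun n x => rfl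
  have hφ0 : ∀ n (x : B n), φ n x = 0 ↔ Subring.inclusion (hBC n) x ∈ maximalIdeal C := fun n x => by
    rw [hφapp, residue_eq_zero_iff]
  have hker : RingHom.ker (φ 0) = (maximalIdeal C).comap (Subring.inclusion (hBC 0)) := by
    ext x; rw [RingHom.mem_ker, hφ0, Ideal.mem_comap]
  -- the images `S' n = φ n (B n)`: local rings, `𝔪(S' n) = φ n (𝔪(B n))`, a dominating chain
  let S' : ℕ → Subring F := fun n => (φ n).range
  haveI hS'loc : ∀ n, IsLocalRing (S' n) := fun n =>
    IsLocalRing.of_surjective' (φ n).rangeRestrict (φ n).rangeRestrict_surjective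
  have hmemS' : ∀ n (b : B n), φ n b ∈ S' n := fun n b => ⟨b, rfl⟩
  have hunit : ∀ n (b : B n), IsUnit (⟨φ n b, hmemS' n b⟩ : S' n) ↔ IsUnit b := by
    intro n b
    constructor
    · rintro ⟨u, hu⟩
      obtain ⟨b', hb'⟩ : ((↑u⁻¹ : S' n) : F) ∈ (φ n).range := (↑u⁻¹ : S' n).2
      have h1 : φ n (b * b') = 1 := by
        rw [map_mul, hb']
        have := congrArg (fun z : S' n => (z : F)) u.mul_inv
        simpa [hu] using this
      by_contra hbu
      have hbm : b * b' ∈ maximalIdeal (B n) :=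
        Ideal.mul_mem_right _ _ ((IsLocalRing.mem_maximalIdeal _).mpr hbu)
      have h2 : b * b' - 1 ∈ maximalIdeal (B n) := by
        refine mem_maximalIdeal_of_inclusion_mem_maximalIdeal C hBC n ((hφ0 n _).mp ?_)
        rw [map_sub, h1, map_one, sub_self]
      have : (1 : B n) ∈ maximalIdeal (B n) := by
        have := Ideal.sub_mem _ hbm h2
        rwa [sub_sub_cancel] at this
      exact (IsLocalRing.maximalIdeal.isMaximal (B n)).ne_top ((Ideal.eq_top_iff_one _).mpr this)
    · rintro ⟨u, rfl⟩
      refine ⟨⟨⟨φ n u, hmemS' n _⟩, ⟨φ n (↑u⁻¹ : B n), hmemS' n _⟩, Subtype.ext ?_, Subtype.ext ?_⟩, rfl⟩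
      · change φ n u * φ n (↑u⁻¹ : B n) = 1
        rw [← map_mul, Units.mul_inv, map_one]
      · change φ n (↑u⁻¹ : B n) * φ n u = 1
        rw [← map_mul, Units.inv_mul, map_one]
  have hmaxS' : ∀ n (b : B n), (⟨φ n b, hmemS' n b⟩ : S' n) ∈ maximalIdeal (S' n) ↔ b ∈ maximalIdeal (B n) := by
    intro n b
    rw [IsLocalRing.mem_maximalIdeal, IsLocalRing.mem_maximalIdeal, mem_nonunits_iff, mem_nonunits_iff, hunit]
  have hS'le : ∀ n, S' n ≤ S' (n + 1) := by
    rintro n _ ⟨b, rfl⟩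
    exact ⟨Subring.inclusion (hdom n).1 b, hφ n b⟩
  have hS'dom : ∀ n, SubringDominates (S' n) (S' (n + 1)) := by
    refine fun n => ⟨hS'le n, ?_⟩
    rintro z ⟨b, rfl⟩ hzinv
    by_cases hz0 : φ n b = 0
    · rw [hz0, inv_zero]; exact (S' n).zero_mem
    by_cases hbu : IsUnit b
    · obtain ⟨u, rfl⟩ := hbu
      refine ⟨(↑u⁻¹ : B n), ?_⟩
      refine (eq_inv_of_mul_eq_one_right ?_)
      rw [← map_mul, Units.mul_inv, map_one]
    · exfalso
      have hbm : b ∈ maximalIdeal (B n) := (IsLocalRing.mem_maximalIdeal _).mpr hbu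
      have hbm' : Subring.inclusion (hdom n).1 b ∈ maximalIdeal (B (n + 1)) := inclusion_mem_maximalIdeal (hdom n) hbm
      have heq : (⟨φ n b, hS'le n (hmemS' n b)⟩ : S' (n + 1)) =
          ⟨φ (n + 1) (Subring.inclusion (hdom n).1 b), hmemS' (n + 1) _⟩ := Subtype.ext (hφ n b).symm
      have hzm : (⟨φ n b, hS'le n (hmemS' n b)⟩ : S' (n + 1)) ∈ maximalIdeal (S' (n + 1)) := by
        rw [heq]; exact (hmaxS' (n + 1) _).mpr hbm'
      have hzunit : IsUnit (⟨φ n b, hS'le n (hmemS' n b)⟩ : S' (n + 1)) := by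
        rw [isUnit_subring_iff_inv_mem]
        exact ⟨hz0, hzinv⟩
      exact (IsLocalRing.mem_maximalIdeal _).mp hzm hzunit
  -- Chevalley: a valuation ring of `κ(C)` dominating every image
  obtain ⟨W, hWdomS'⟩ := exists_valuationSubring_dominates S' hS'dom
  have hW : ∀ n (x : B n), φ n x ∈ W := fun n x => (hWdomS' n).1 (hmemS' n x)
  have hWdom : ∀ n (x : B n), x ∈ maximalIdeal (B n) → W.valuation (φ n x) < 1 := by
    intro n x hx
    have h := (subringDominates_valuationSubring_iff (hWdomS' n).1).mp (hWdomS' n) ⟨φ n x, hmemS' n x⟩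
    exact h.mp ((hmaxS' n x).mpr hx)
  -- the remaining hypotheses of §3
  have h0 : ∃ x ∈ maximalIdeal (B 0), φ 0 x ≠ 0 := by
    obtain ⟨x, hx, hxC⟩ := hsep
    exact ⟨x, hx, fun h => hxC ((hφ0 0 x).mp h)⟩
  have hfrac : ∀ n (x : B n), ∃ a b : B 0, φ 0 b ≠ 0 ∧ φ n x * φ 0 b = φ 0 a := by
    intro n x
    obtain ⟨a, b, hb, hab⟩ := hfracC (Subring.inclusion (hBC n) x)
    refine ⟨a, b, fun h => hb ((hφ0 0 b).mp h), ?_⟩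
    rw [hφapp, hφapp, hφapp, ← map_mul]
    congr 1
    exact Subtype.ext hab
  have hdim' : Ring.KrullDimLE 1 (B 0 ⧸ RingHom.ker (φ 0)) := by
    rw [Ring.krullDimLE_iff] at hdim ⊢
    rwa [ringKrullDim_eq_of_ringEquiv (Ideal.quotEquivOfEq hker)]
  obtain ⟨n₁, hn₁⟩ := eventually_not_satellite_of_shadow hdom φ hφ W hW hWdom hprin h0 hfrac hdim'
  obtain ⟨n₂, hn₂⟩ := eventually_residue_surjective_of_shadow hdom φ hφ W hW hWdom h0 hfrac hdim'
  exact ⟨max n₁ n₂, fun n hn => ⟨hn₁ n (le_of_max_le_left hn), hn₂ n (le_of_max_le_right hn)⟩⟩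

end Overring
end Summit.ResolutionOfSingularities.ResolutionOfSingularities.Cruxes.SigmaMaxModifications.IdeasL1C5

end
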